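import Summits.HodgeConjecture.HodgeConjecture.Theorems.Ring2HypothesesCMPivot
import Summits.HodgeConjecture.HodgeConjecture.Theorems.Ring2TransportWeilTypeExactness
import Summits.HodgeConjecture.HodgeConjecture.Theorems.Ring2BindersAbelianSchemeVHCCMGerm
import Summits.HodgeConjecture.HodgeConjecture.Theorems.Ring2TransportSemiregularGerm
import Literature.AlgebraicGeometry.HodgeTheory.BlochSemiregularSpread
import Literature.AlgebraicGeometry.HodgeTheory.HodgeTypeConjugation
import Literature.AlgebraicGeometry.Motives.AbelianFibresOfAbelianFibre
import HarnessLib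

/-!
# HSemireg venture · general structure (G4) — the WIRING, Bloch / lci form: a uniform Bloch-semiregular CYCLE at CM fibres ⟹ `HC_AV`, modulo NAMED hypotheses

HONEST FRAMING (speculative tier of cell `pub-hsemireg`, team «general structure», seat G4; verbatim the cell's
wording rule): **nothing here says `HC_AV` or `HC_CM` is proved; every implication carries its named hypotheses.**
No `sorry`, no new axiom; axioms `propext`, `Classical.choice`, `Quot.sound`. `HC_CM` is the OPEN route item
`Summit.HodgeConjecture.HodgeConjecture.Theses.RankFourFaces.CMAbelianHodge` (stmt-HodgeConjecture-3052), always a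
binder; `HC_AV` is `Theses.PadicSemiregularLift.HodgeAbelianVarieties` (stmt-HodgeConjecture-1333). Companion of
`GeneralStructureWiring.lean` (the SHEAF form, Buchweitz–Flenner Thm. 5.1); this file is the CYCLE form, whose
transfer theorem is Bloch 1972 Thm. (7.4)/(7.5) = Buchweitz–Flenner Thm. 5.2 at `I = {p}` — the tree's refereed
class-level named fact `HodgeTheory.BlochSemiregularSpread n p` — because THIS is the map the cell's engines compute
for cycles: Bloch's `π : H¹(Z, N_Z) → H^{p+1}(X, Ω^{p-1})`, whose injectivity is the tree's real predicate
`IsBlochSemiregular i n p` (`BlochSemiregularityMapReal.lean`).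

## The hypothesis (ours, speculative) and the rows

* `UniformBlochLiftAtCM` (§1): in EXACTLY the antecedents of ring 2's CM-germ leaf `Ring2.Hypotheses.LocalVHCAtCM`
  (smooth projective family of relative dimension `m` over a smooth irreducible quasi-projective base, CM abelian fibre
  `A₀ ≅ 𝒳_{s₀}`, global class `G` rational `(p,p)` on abelian-presented fibres, `G|_{A₀}` ALGEBRAIC): there is a global
  class `H` on `𝒳` which is RATIONAL and ALGEBRAIC on every fibre (the "trivially transported" part — in the cell's
  seed shape `[Z] = q·hⁿ + w` it is `q·hⁿ`, a power of the relative polarization) such that EITHER `(G - H)|_{A₀} = 0`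
  OR `(G - H)|_{A₀}` is supported on ONE integral local complete intersection `Z ↪ A₀` of codimension `p` which is
  BLOCH-SEMIREGULAR (`IsBlochSemiregular`) — hence, by purity, a multiple of `cl(Z)`. This is the all-families,
  all-codimensions form of the cell's object `HasBlochSeedAt` (`WeilClassesBlochSeed.lean`) asked at every CM anchor.
* B-1 `localVHCAtCM_of_blochSpread_of_catanese_of_uniformBlochLift`:
  `(∀ m p, BlochSemiregularSpread m p) → catanese2002 → UniformBlochLiftAtCM → LocalVHCAtCM` (proved here; Catanese
  2002 — deformations of an abelian variety are abelian — turns "Hodge on abelian-presented fibres" into "Hodge on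
  every fibre", which Bloch's theorem needs; the SHEAF row of the companion file does not need it).
* B-2 `hc_av_of_hc_cm_of_deligne1982_of_blochSpread_of_catanese_of_uniformBlochLift`: **`HC_AV` modulo (`HC_CM`,
  Deligne 1982 Prop. 6.1, Bloch 1972 Thm. 7.4 / BF Thm. 5.2, Catanese 2002 Thm. 4.1, the uniform Bloch lift)** —
  four refereed printed theorems typed as named facts, one open item, one speculative hypothesis of ours.
* B-3 `hodgeWeilType_of_…` (ring 2's exactness `HC_AV ↔ HodgeWeilType`) and B-4 the transport half `CMToAbelian`
  without `HC_CM`.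

VACUITY LEDGER (red team): as in the companion file — every hypothesis but the uniform lift is on-path or printed;
the lift has no on-path lemma; antecedents jointly satisfiable (ring 2's audit). Specific to the CYCLE form: (a) the
disjunct `(G - H)|_{A₀} = 0` is what keeps the trivial classes (`G = 0`, `G = hᵖ`) from demanding a semiregular lci
that need not exist on a SIMPLE CM abelian variety (no abelian subvarieties; complete intersections of ample divisors
are NOT Bloch-semiregular in dimension ≥ 4 — the cell's no-go census, `WeilClassesBlochSeed.lean` docstring (4));
(b) a single translated abelian subvariety IS Bloch-semiregular but never carries `q·hⁿ + w`, `w ≠ 0` Weil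
(kernel-checked no-go (1) ibid.) — so on the Weil components the hypothesis lives or dies with representatives that
forget their constituents (smoothings, linked residuals, degeneracy loci, Schoen/Prym-type cycles): the STEP-0 classes
(A)/(B). Numbers: 1 new `@[conjecture] def`, 6 theorems, 0 sorries, 0 new facts.

## References (bib keys)

Bloch1972Semiregularity (Thm. 7.1, 7.4, Remark 7.5), BuchweitzFlenner2003 (Thm. 5.2, (8.1), Prop. 8.2),
VoisinTorino1994 (Voisin, Lecture 3 «Noether–Lefschetz loci», Thm. 2.3–2.4, pp. 154–155), Deligne1982HodgeCycles (Prop. 6.1; §4), CharlesSchnell2014Notes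
(Prop. 11.3.11, Thm. 11.5.11), Catanese2002DeformationTypes (§4 Thm. 4.1, 4.6), Fulton1998 (§19.1 purity),
VoisinHodgeI2002 (§9.2.1), VoisinHodgeII2003 (§3.1.2).
-/

noncomputable section

open CategoryTheory
open Literature.AlgebraicGeometry Literature.AlgebraicGeometry.Motives
open Literature.AlgebraicGeometry.HodgeTheory
open Literature.AlgebraicGeometry.Deligne1982 (deligne1982_cmDenseMumfordTateFamilies)

namespace Summit.Ventures.HSemireg.GeneralStructure

open Summit.HodgeConjecture.HodgeConjecture
open Summit.HodgeConjecture.HodgeConjecture.Ring2.Hypotheses (CMAnchoredFamilies LocalVHCAtCM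
  hc_av_of_hc_cm_of_cmAnchoredFamilies_of_localVHCAtCM cmToAbelian_of_cmAnchoredFamilies_of_localVHCAtCM)
open Summit.HodgeConjecture.HodgeConjecture.Ring2Transport (HodgeWeilType pathIn hodgeAbelianVarieties_iff_hodgeWeilType)

/-! ### §0 The CM-pivot vocabulary (verbatim ring 2's local notations) -/

/-- `IsCM[A]` — CM type in the eigenvalue typing (verbatim `Ring2HypothesesCMPivot`). Local notation only. -/
local notation3 (prettyPrint := false) "IsCM[" A "]" =>
  ∃ (ψ : A ⟶ A) (μ : Fin (2 * AbelianVariety.dim A) → ℂ), Function.Injective μ ∧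
    ∀ i, Module.End.HasEigenvalue (HodgeTheory.complexBetti.map ψ.hom.hom.hom 1).hom (μ i)

/-- `QProj[X]` — `X` quasi-projective over `ℂ` (inlined body of `HodgeTheory.IsQuasiProjectiveOver X`).
Local notation only. -/
local notation3 (prettyPrint := false) "QProj[" X "]" =>
  ∃ (P : SchemeOver ℂ) (j : X ⟶ P), IsProjectiveOver P ∧ AlgebraicGeometry.IsOpenImmersion j.left

/-- `FibreIncl[f, B, e, s]` — `e` presents `B` as the fibre of `f` over `s`. Local notation only. -/
local notation3 (prettyPrint := false) "FibreIncl[" f ", " B ", " e ", " s "]" =>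
  ∃ i : AbelianVariety.X B ≅ fiberOver f s, e = CategoryStruct.comp i.hom (fiberι f s)

/-- `HodgeAlong[S, 𝒳, f, G, p]` — `G` is rational `(p,p)` on every fibre presented as an abelian variety.
Local notation only. -/
local notation3 (prettyPrint := false) "HodgeAlong[" S ", " 𝒳 ", " f ", " G ", " p "]" =>
  ∀ (B : AbelianVariety ℂ) (eB : AbelianVariety.X B ⟶ 𝒳) (u : ComplexPoints S),
    FibreIncl[f, B, eB, u] →
      HodgeTheory.IsRationalClass (HodgeTheory.complexBetti.map eB (2 * p) G) ∧
      HodgeTheory.IsOfHodgeType B.dim B.X (2 * p) p p (HodgeTheory.complexBetti.map eB (2 * p) G)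

/-! ### §1 The team's hypothesis, cycle form -/

/-- **`UniformBlochLiftAtCM` — UNIFORM SEMIREGULARITY AT CM POINTS, cycle (Bloch / lci) form (the «general structure»
hypothesis of cell `pub-hsemireg`, team G; OURS, SPECULATIVE, OPEN — NOT a Literature fact).** In exactly the
antecedents of ring 2's `Ring2.Hypotheses.LocalVHCAtCM`: there is a global class `H ∈ H^{2p}(𝒳(ℂ); ℂ)` which is
rational and ALGEBRAIC on every fibre, such that either `(G - H)|_{A₀} = 0`, or `(G - H)|_{A₀}` is SUPPORTED on an
integral local complete intersection `i : Z ↪ A₀` of codimension `p` (`IsRegularImmersionOfCodim i p`, points of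
coheight `≥ p`) which is Bloch-semiregular (`IsBlochSemiregular i m p`: surjectivity of the dual
`H^{m-p-1}(Ω^{m-p+1}_{A₀}) → H^{m-p-1}(Z, N^∨ ⊗ ω_Z)` of Bloch's `π`, Buchweitz–Flenner (8.1)(2)) — i.e. by purity
`(G - H)|_{A₀} = μ · cl(Z)`. These are verbatim the hypotheses of the tree fact `BlochSemiregularSpread m p` at the
anchor. WHAT THE TEAM COMPUTES: instances on the Weil components at `E^{2n}`-type CM points with `H = -q·hⁿ` and `Z`
a torus-stable / Schoen-type / special-divisor cycle (STEP-0 classes (A), (B)). CLOSEST PRINT (semiregular `Z`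
GIVEN): Bloch 1972 Thm. (7.1)/(7.4); no statement PRODUCING `Z` from algebraicity is in print. NOT asserted.
POSITION (RED-GS GS-14, 2026-08-22, kernel: `uniformBlochLift_sandwich`, `uniformBlochLiftAtCM_of_hc_av_of_catanese` in
`GeneralStructureWiringConverses.lean`): this statement is IMPLIED by `HC_AV` (+ Catanese 2002) through the free correction `H := G`
(`blochLift_conclusion_of_fibrewise_algebraic`), and implies `CMToAbelian` modulo {anchors, Bloch 7.4, Catanese} — it sits BETWEEN
`CMToAbelian` (stmt-16267) and `HC_AV`; modulo {Deligne 1982 Prop. 6.1, Bloch 7.4, Catanese} `HC_CM ∧ UniformBlochLiftAtCM ↔ HC_AV`.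
Its content is the TRANSPORT of algebraicity from the CM fibre along the component; a semiregular representative is a proof strategy for an
instance, not something the hypothesis asserts. A CASE of the summit (on-path: `HodgeConjecture → UniformBlochLiftAtCM`, `uniformBlochLift_position`).
The referee label «plausibly false as a `∀`-statement» (ring 2, ref1 F5) does NOT apply to the cycle forms (refuting this statement would refute
`HC_AV` modulo Catanese); it applies to the SHEAF forms only. (Docstring revised 2026-08-22, words only, no declaration changed.)
[cite: Bloch1972Semiregularity, Thm. (7.1), (7.4) and Remark (7.5)]
[cite: BuchweitzFlenner2003, Thm. 5.2, (8.1) and Prop. 8.2] [cite: VoisinTorino1994, Lecture 3 (Noether–Lefschetz loci), Thm. 2.3–2.4, pp. 154–155]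
[status: open] -/
@[conjecture] def UniformBlochLiftAtCM : Prop :=
  ∀ (S 𝒳 : SchemeOver ℂ) (f : 𝒳 ⟶ S) (m p : ℕ) (G : HodgeTheory.complexBetti 𝒳 (2 * p))
    (s₀ : ComplexPoints S) (A₀ : AbelianVariety ℂ) (e₀ : A₀.X ⟶ 𝒳),
    QProj[𝒳] → QProj[S] → AlgebraicGeometry.Smooth S.hom → IrreducibleSpace S.left →
    IsSmoothProjectiveFamily f m →
    FibreIncl[f, A₀, e₀, s₀] → IsCM[A₀] →
    HodgeTheory.complexBetti.map e₀ (2 * p) G ∈ HodgeTheory.algebraicClasses A₀.X p →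
    HodgeAlong[S, 𝒳, f, G, p] →
    ∃ H : HodgeTheory.complexBetti 𝒳 (2 * p),
      (∀ t : ComplexPoints S, IsRationalClass (complexBetti.map (fiberι f t) (2 * p) H) ∧
        complexBetti.map (fiberι f t) (2 * p) H ∈ algebraicClasses (fiberOver f t) p) ∧
      (complexBetti.map e₀ (2 * p) (G - H) = 0 ∨
        ∃ (Z : AlgebraicGeometry.Scheme.{0}) (i : Z ⟶ A₀.X.left),
          AlgebraicGeometry.IsClosedImmersion i ∧ IsRegularImmersionOfCodim i p ∧
          AlgebraicGeometry.IsIntegral Z ∧ (∀ z ∈ Set.range i.base, (p : ℕ∞) ≤ Order.coheight z) ∧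
          IsBlochSemiregular i m p ∧
          complexBetti.map e₀ (2 * p) (G - H) ∈ classesSupportedOn A₀.X (Set.range i.base) (2 * p))

/-! ### §2 Row B-1: Bloch's theorem transports the uniform cycle lift into ring 2's CM-germ leaf -/

/-- **B-1 — `LocalVHCAtCM` from the uniform Bloch lift, Bloch's semiregularity theorem (class form) and Catanese's
theorem (kernel-checked; literature inputs REFEREED; no `HC_CM`, no preprint).** Every fibre is an abelian variety
(Catanese, fed with `dim A₀ = m`), so `G`, hence `G - H`, is rational `(p,p)` on EVERY fibre; in the degenerate case
`(G - H)|_{𝒳_{s₀}} = 0` the flat class `G - H` vanishes on the path component of `s₀` (`transportFun_map_fiberι`) and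
`G|_{𝒳_t} = H|_{𝒳_t}` is algebraic; otherwise `BlochSemiregularSpread m p` at the anchor `A₀ ≅ 𝒳_{s₀}` gives an open
`U ∋ s₀` on which `(G - H)|_{𝒳_t}` is algebraic, and `G|_{𝒳_t} = (G - H)|_{𝒳_t} + H|_{𝒳_t}`.
[cite: Bloch1972Semiregularity, Thm. (7.4)] [cite: BuchweitzFlenner2003, Thm. 5.2]
[cite: Catanese2002DeformationTypes, §4 Thm. 4.1 and Thm. 4.6] [cite: VoisinHodgeII2003, §3.1.2] -/
theorem localVHCAtCM_of_blochSpread_of_catanese_of_uniformBlochLift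
    (hB : ∀ m p : ℕ, BlochSemiregularSpread m p) (hC : catanese2002_abelianFibres_of_abelianFibre)
    (hL : UniformBlochLiftAtCM) : LocalVHCAtCM := by
  intro S 𝒳 f m p G s₀ A₀ e₀ h𝒳 hS hsm hirr hf hA₀ hCM halg hG
  obtain ⟨H, hH, hcase⟩ := hL S 𝒳 f m p G s₀ A₀ e₀ h𝒳 hS hsm hirr hf hA₀ hCM halg hG
  obtain ⟨i₀, hi₀⟩ := hA₀
  have hq𝒳 : IsQuasiProjectiveOver 𝒳 := h𝒳
  have hqS : IsQuasiProjectiveOver S := hS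
  -- every fibre is an abelian variety (Catanese), so `G - H` is rational `(p,p)` on every fibre
  have hdim : A₀.dim = m := Ring2.Binders.dim_eq_of_iso_fiberOver hf i₀
  have hfam : IsSmoothProjectiveFamily f A₀.dim := hdim ▸ hf
  have hWfib : ∀ s : ComplexPoints S,
      IsRationalClass (complexBetti.map (fiberι f s) (2 * p) (G - H)) ∧
        IsOfHodgeType m (fiberOver f s) (2 * p) p p (complexBetti.map (fiberι f s) (2 * p) (G - H)) := by
    intro s
    obtain ⟨B, -, ⟨iB⟩⟩ := hC f A₀ hq𝒳 hqS hirr hsm hfam ⟨s₀, ⟨i₀⟩⟩ s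
    have h := hG B (iB.hom ≫ fiberι f s) s ⟨iB, rfl⟩
    have he : complexBetti.map (iB.hom ≫ fiberι f s) (2 * p) G =
        complexBetti.map iB.hom (2 * p) (complexBetti.map (fiberι f s) (2 * p) G) := by
      rw [complexBetti.map_comp]
      rfl
    rw [he] at h
    have hBdim : B.dim = m := Ring2.Binders.dim_eq_of_iso_fiberOver hf iB
    have hX : IsSmoothProjective m (fiberOver f s) := hf.isSmoothProjective s
    have hGs : IsRationalClass (complexBetti.map (fiberι f s) (2 * p) G) ∧
        IsOfHodgeType m (fiberOver f s) (2 * p) p p (complexBetti.map (fiberι f s) (2 * p) G) :=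
      ⟨(isRationalClass_map_iff_of_iso iB).1 h.1, hBdim ▸ (isOfHodgeType_map_iff_of_iso iB).1 h.2⟩
    have hHs := hH s
    rw [map_sub]
    refine ⟨?_, hGs.2.sub hX (isOfHodgeType_of_mem_algebraicClasses_of_isSmoothProjective hX p hHs.2)⟩
    have hr := hGs.1.add (hHs.1.smul (-1 : ℚ))
    rwa [Rat.cast_neg, Rat.cast_one, neg_one_smul, ← sub_eq_add_neg] at hr
  -- `G|_t = (G - H)|_t + H|_t`
  have hsplit : ∀ t : ComplexPoints S, complexBetti.map (fiberι f t) (2 * p) G =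
      complexBetti.map (fiberι f t) (2 * p) (G - H) + complexBetti.map (fiberι f t) (2 * p) H := by
    intro t
    rw [map_sub, sub_add_cancel]
  -- the anchor in Bloch's spelling: `i₀^* ((G - H)|_{𝒳_{s₀}}) = e₀^* (G - H)`
  have he₀ : complexBetti.map i₀.hom (2 * p) (complexBetti.map (fiberι f s₀) (2 * p) (G - H)) =
      complexBetti.map e₀ (2 * p) (G - H) := by
    rw [hi₀, complexBetti.map_comp]
    rfl
  rcases hcase with h0 | ⟨Z, i, hci, hreg, hint, hcoh, hsr, hsupp⟩
  · -- degenerate case: the flat class `G - H` vanishes at `s₀`, hence on the path component of `s₀`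
    have h0' : complexBetti.map (fiberι f s₀) (2 * p) (G - H) = 0 := by
      apply (complexBetti.bijective_map_of_iso i₀ (2 * p)).1
      rw [he₀, h0, map_zero]
    have hU : IsCohomologicallyLocallyTrivialOn f (Set.univ : Set (ComplexPoints S)) :=
      isCohomologicallyLocallyTrivialOn_univ_of_isQuasiProjectiveOver f hf hqS hsm
    haveI := hsm
    haveI : LocallyPathConnectedSpace (ComplexPoints S) := locallyPathConnectedSpace_complexPoints_of_smooth S
    refine ⟨pathComponentIn Set.univ s₀, isOpen_univ.pathComponentIn s₀,
      mem_pathComponentIn_self (Set.mem_univ _), fun t ht ↦ ?_⟩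
    have hJ : JoinedIn Set.univ s₀ t := ht
    set γ₀ : Path s₀ t := hJ.somePath
    have hγ : ∀ ρ, γ₀ ρ ∈ (Set.univ : Set (ComplexPoints S)) := fun _ ↦ Set.mem_univ _
    have hGt : complexBetti.map (fiberι f t) (2 * p) (G - H) =
        transportFun f (2 * p) hU ⟦pathIn γ₀ Set.univ hγ⟧ (complexBetti.map (fiberι f s₀) (2 * p) (G - H)) :=
      (transportFun_map_fiberι f (2 * p) hU ⟦pathIn γ₀ Set.univ hγ⟧ (G - H)).symm
    rw [hsplit t, hGt, h0', ← transportLinear_apply, map_zero, zero_add]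
    exact (hH t).2
  · -- Bloch's theorem at the anchor `A₀ ≅ 𝒳_{s₀}`
    obtain ⟨U, hUo, hs₀U, hU⟩ := hB m p A₀.X Z i (complexBetti.map e₀ (2 * p) (G - H)) 𝒳 S f s₀ i₀ (G - H)
      hci hreg hint hcoh hsr hsupp hf hq𝒳 hqS hsm hWfib he₀
    refine ⟨U, hUo, hs₀U, fun t ht ↦ ?_⟩
    rw [hsplit t]
    exact Submodule.add_mem _ (hU t ht) (hH t).2

/-! ### §3 Rows B-2 … B-4: the end statement reads `HC_AV` (equivalently `HodgeWeilType`) modulo named hypotheses -/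

/-- **B-2 — `HC_CM ∧ [Deligne 1982 Prop. 6.1] ∧ [Bloch 1972 Thm. 7.4 / BF Thm. 5.2] ∧ [Catanese 2002] ∧
UniformBlochLiftAtCM ⟹ HC_AV`** (kernel-checked composition of B-1 with ring 2's CM pivot
`hc_av_of_hc_cm_of_cmAnchoredFamilies_of_localVHCAtCM` and `Ring2.Deform.cmAnchoredFamilies_of_deligne1982`). THE END
STATEMENT of seat G4, cycle form: `HC_AV` modulo one open item (`HC_CM`, load-bearing, consumed once at the CM fibre),
three refereed printed theorems typed as named facts, and the team's speculative uniform lift.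
[cite: Deligne1982HodgeCycles, Prop. 6.1] [cite: Bloch1972Semiregularity, Thm. (7.4)]
[cite: Catanese2002DeformationTypes, §4 Thm. 4.1] [cite: CharlesSchnell2014Notes, Prop. 11.3.11 (proof) and Thm. 11.5.11] -/
theorem hc_av_of_hc_cm_of_deligne1982_of_blochSpread_of_catanese_of_uniformBlochLift
    (hCM : Theses.RankFourFaces.CMAbelianHodge) (hD : deligne1982_cmDenseMumfordTateFamilies)
    (hB : ∀ m p : ℕ, BlochSemiregularSpread m p) (hC : catanese2002_abelianFibres_of_abelianFibre)
    (hL : UniformBlochLiftAtCM) : Theses.PadicSemiregularLift.HodgeAbelianVarieties :=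
  hc_av_of_hc_cm_of_cmAnchoredFamilies_of_localVHCAtCM hCM (Ring2.Deform.cmAnchoredFamilies_of_deligne1982 hD)
    (localVHCAtCM_of_blochSpread_of_catanese_of_uniformBlochLift hB hC hL)

/-- **B-3 — the coordinator's phrasing: the bundle gives `HodgeWeilType`**, by ring 2's exactness
`HC_AV ↔ HodgeWeilType` (`Ring2Transport.hodgeAbelianVarieties_iff_hodgeWeilType`); read with B-2, the end statement
is `HC_AV`. [cite: Deligne1982HodgeCycles, §4 Lemma 4.5 and Remark 4.10] [cite: Bloch1972Semiregularity, Thm. (7.4)] -/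
theorem hodgeWeilType_of_hc_cm_of_deligne1982_of_blochSpread_of_catanese_of_uniformBlochLift
    (hCM : Theses.RankFourFaces.CMAbelianHodge) (hD : deligne1982_cmDenseMumfordTateFamilies)
    (hB : ∀ m p : ℕ, BlochSemiregularSpread m p) (hC : catanese2002_abelianFibres_of_abelianFibre)
    (hL : UniformBlochLiftAtCM) : HodgeWeilType :=
  hodgeAbelianVarieties_iff_hodgeWeilType.1
    (hc_av_of_hc_cm_of_deligne1982_of_blochSpread_of_catanese_of_uniformBlochLift hCM hD hB hC hL)

/-- **B-4 — the TRANSPORT HALF alone, no `HC_CM`**: `CMAnchoredFamilies ∧ [Bloch 7.4] ∧ [Catanese] ∧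
UniformBlochLiftAtCM ⟹ CMToAbelian` (stmt-HodgeConjecture-16267, `HC_CM → HC_AV` in the item typing).
[cite: Deligne1982HodgeCycles, Prop. 6.1] [cite: Bloch1972Semiregularity, Thm. (7.4)] -/
theorem cmToAbelian_of_cmAnchoredFamilies_of_blochSpread_of_catanese_of_uniformBlochLift
    (hMT : CMAnchoredFamilies) (hB : ∀ m p : ℕ, BlochSemiregularSpread m p)
    (hC : catanese2002_abelianFibres_of_abelianFibre) (hL : UniformBlochLiftAtCM) :
    Theses.RankFourFaces.CMToAbelian :=
  cmToAbelian_of_cmAnchoredFamilies_of_localVHCAtCM hMT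
    (localVHCAtCM_of_blochSpread_of_catanese_of_uniformBlochLift hB hC hL)

/-- **POSITION of the cycle form** (conjunction of tree theorems): the uniform Bloch lift + Bloch 7.4 + Catanese give
ring 2's CM-germ leaf `LocalVHCAtCM`, which — granted Deligne 1982 Prop. 6.1 and Catanese 2002 — is EXACTLY the
supplement `HC_CM` needs: `CMToAbelian ↔ (HC_CM → LocalVHCAtCM)`; and `HC_AV ↔ HodgeWeilType`.
[cite: Deligne1982HodgeCycles, Prop. 6.1 and §4] [cite: Catanese2002DeformationTypes, §4 Thm. 4.1 and Thm. 4.6] -/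
theorem blochForm_position :
    ((∀ m p : ℕ, BlochSemiregularSpread m p) → catanese2002_abelianFibres_of_abelianFibre →
      UniformBlochLiftAtCM → LocalVHCAtCM) ∧
    (deligne1982_cmDenseMumfordTateFamilies → catanese2002_abelianFibres_of_abelianFibre →
      (Theses.RankFourFaces.CMToAbelian ↔ (Theses.RankFourFaces.CMAbelianHodge → LocalVHCAtCM))) ∧
    (Theses.PadicSemiregularLift.HodgeAbelianVarieties ↔ HodgeWeilType) :=
  ⟨localVHCAtCM_of_blochSpread_of_catanese_of_uniformBlochLift,
    Ring2.Binders.cmToAbelian_iff_localVHCAtCM_of_hc_cm_of_deligne1982_of_catanese2002,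
    hodgeAbelianVarieties_iff_hodgeWeilType⟩

/-! ## Audit: nothing is decided here

Every theorem above whose conclusion is `HC_AV`, `HodgeWeilType`, `CMToAbelian` or `LocalVHCAtCM` has among its
hypotheses the team's OPEN, SPECULATIVE `UniformBlochLiftAtCM` together with named printed facts (Deligne 1982
Prop. 6.1 or `CMAnchoredFamilies`; `BlochSemiregularSpread`; Catanese 2002) and — where load-bearing — `HC_CM` by
name; or it is a conjunction of tree theorems. Axiom closures: the three standard axioms only. -/

#print axioms Summit.Ventures.HSemireg.GeneralStructure.localVHCAtCM_of_blochSpread_of_catanese_of_uniformBlochLift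
#print axioms Summit.Ventures.HSemireg.GeneralStructure.hc_av_of_hc_cm_of_deligne1982_of_blochSpread_of_catanese_of_uniformBlochLift

end Summit.Ventures.HSemireg.GeneralStructure

end
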